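import Literature.MathematicalPhysics.QuantumFieldTheory.Balaban1983to89.Node00.RStepRepr218
import Literature.MathematicalPhysics.QuantumFieldTheory.Balaban1983to89.Node00.RStepSlotOfRecord
import Literature.MathematicalPhysics.QuantumFieldTheory.Balaban1983to89.T4DressedR

/-!
# YM-DAG node N19 (= NE7 proper) — ROW MF-ID, GENERIC HALF (sibling): MF-R GENERIC — at the IDENTITY SELECTOR def-R's R-step is a t-free
# `{0,1}`-multiplier on every slot family dominated by the reference one (generic over def-R's `Step.Repr218`, any gauge group, any `N`)

Cell `pub-ymgap`, HUMAN RULING D-0062 (Track A), R141 (C) wider-strategy seat `pub-ymgap-dag-n19-e` (strategy s3 = ALTERNATIVE CURRENCY).  Sibling of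
`Summits/…/Theorems/BalabanUVNodesN19MGFFormKernelChain.lean` (MF-Σ, the heterogeneous kernel chain ⇒ `MGFForm`) under the 400-line rule; ROW MF-ID of the LENS
decomp v5 (`ym-lens-BalabanUVNodes-decomp` g5, memo `LENS-decomp.md` v5 07acd831aa830b9f §v5.2 ∕ §v5.5) SPLIT by dag-lead WORDS-125 ∕ 126 ∕ 131 (pub-ymgap INBOX
l.15615 ∕ l.15621 ∕ l.15764, REBALANCE №65): the GENERIC half (b) is this seat's; the AT-RECORD half (c) (`dag-n19-d`, `…N19MGFKernelTower` ∕ `…N19MGFFormAtRecord`)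
CITES the lemmas below instead of re-proving them; the K14-β GUARD− (a) is `dag-n19-c`'s.  This file is the LENS v5 sketch §3 (`LensDecompNE7v5.sketch.lean`
a021c8a8f95b66cf, `YMLens.DecompNE7v5`, farm rc 0) LIFTED AND CREDITED — `self_div_eq_of_sandwich`, `rratio_self_eq_ite`, `rratio_self_reslot_eq`,
`rstepOfSel_id_reslot_TexpA`, with the re-slotting `reslot r T′` written inline as `{ r with TexpA := T′ }` (no `def`) — plus, NEW, the sandwich hypothesis
DISCHARGED from pointwise slot domination (`fibreIntegral_const_sandwich`, `rterm_reslot_sandwich`, `rstepOfSel_id_TexpA_of_slot_sandwich`) and its birth instance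
(`slot_sandwich_of_exp_dressing`, `rstepOfSel_id_TexpA_exp_dressing`; `T4DressedR.exp_dressing_bounds`).  The (α) pair-step `rstepOfSelα` of the sketch (ROW MF-α,
definition lane, director's word first) is NOT here.

WHAT IT SAYS ([Balaban1989LargeFieldI] (0.3) p. 176 is cited for the SHAPE of def-R's `rstepOfSel` ∕ `rratio` only).  def-R's R-step on a (2.18) representation
`r` with selector `sel` and `Z′`-variables `fib` re-slots `(𝐓e^A)′(a′) := (𝐓e^A)(a′) · Σ_{a : sel a = a′} ∫⌈_{fib a} t_a ∕ ∫⌈_{fib a} t_{a′}` (`rstepOfSel_TexpA`), the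
ratios read off `r` ITSELF.  Run on a RE-SLOTTED representation `{ r with TexpA := T′ }` (same sequences, characters, regions; e.g. the DRESSED slots of the same
history tree — NODE 00's F3 convention), at the identity selector the only summand is the own ratio `∫⌈t′_{a′} ∕ ∫⌈t′_{a′} ∈ {0, 1}`; under a two-sided sandwich
`m·∫⌈t_a ≤ ∫⌈t′_a ≤ M·∫⌈t_a` with `0 < m` it EQUALS the reference family's own ratio — so `(R_id T′)(a′) = T′(a′) · [∫⌈t_{a′} ≠ 0]`, a t-FREE `{0,1}`-multiplier
(§1); and the sandwich holds as soon as `m·T ≤ T′ ≤ M·T` pointwise with measurable `0 ≤ χ ≤ 1`, `0 ≤ T ≤ C` (§2), in particular for `T′ = T·e^{tF}`, `|F| ≤ B`,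
`m, M = e^{∓|t|B}` (§3).

HONEST FRAMING — what this is NOT.  Elementary order arithmetic + `lmarginal` monotonicity; nothing of Bałaban's instantiated; no selector OF RECORD, no
`classWeightOfDatum₉`, no `tstepOfRecord` (module (c)); `MGFForm` at the record NOT discharged here; NE7 ∕ NE1′ NOT proved; N19 NOT discharged (0∕1); K3′
`SpineGivenEndpointR12` (stmt-QuantumFields-19908) NOT claimed — `--supports … --as helper`; counts UNMOVED (discharged 5∕27).  No `sorry`, no `axiom`, no `def`, no
`instance`, no `notation`.  One finite T⁴ programme at fixed `ε` — NOT the continuum limit on ℝ⁴, NOT infinite volume, NOT OS, NOT a mass gap, NOT the Clay problem.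
-/

noncomputable section

namespace Summit.QuantumFields.YangMills.BalabanUVNodes.N19MGFFormKernelChainRStep

open MeasureTheory
open scoped ENNReal
open Literature.MathematicalPhysics.QuantumFieldTheory.Balaban1983to89
open Literature.MathematicalPhysics.QuantumFieldTheory.Balaban1983to89.Node00
open Literature.MathematicalPhysics.QuantumFieldTheory.Balaban1983to89.B15.BasicStep (fibreIntegral lmarginal_ofReal_le)
open Literature.MathematicalPhysics.QuantumFieldTheory.Balaban1983to89.T4DressedR (FibreIndep lmarginal_ofReal_mul_pull exp_dressing_bounds)
open T4Continuum

variable {P : Params} {G : Type*} [GaugeGroup G] [MeasurableSpace G] [HaarData G] {j : ℕ}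

/-! ## §1 The identity-selector algebra (LENS v5 sketch §3, lifted and credited) -/

/-- Order arithmetic: under a two-sided sandwich `m·I₀ ≤ I ≤ M·I₀` with `0 < m` and `0 ≤ I₀`, the self-ratios agree: `I∕I = I₀∕I₀` (both `0` or both `1`).
(LENS v5 sketch §3, verbatim.) [folklore] -/
theorem self_div_eq_of_sandwich {I I₀ m M : ℝ} (hm : 0 < m) (h0 : 0 ≤ I₀) (hlo : m * I₀ ≤ I) (hhi : I ≤ M * I₀) :
    I / I = I₀ / I₀ := by
  rcases h0.eq_or_lt with h | h
  · have hI0 : I ≤ 0 := by rw [← h, mul_zero] at hhi; exact hhi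
    have hI1 : 0 ≤ I := by rw [← h, mul_zero] at hlo; exact hlo
    have hI : I = 0 := le_antisymm hI0 hI1
    rw [hI, ← h]
  · have hI : 0 < I := lt_of_lt_of_le (mul_pos hm h) hlo
    rw [div_self hI.ne', div_self h.ne']

/-- A self-ratio of def-R's `rratio` is `0` or `1`: `∫⌈t_a ∕ ∫⌈t_a = [∫⌈t_a ≠ 0]` (LENS v5 sketch §3, verbatim; the `DecidableEq (PBond P j)` instance the fibre
integrals read is the EXPLICIT binder `iP`, def-R TS-8). [cite: Balaban1989LargeFieldI, (0.3) p.176 (bookkeeping)] -/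
theorem rratio_self_eq_ite (iP : DecidableEq (PBond P j)) (r : Step.Repr218 P G j) (fib : r.Adm → Finset (PBond P j)) (a : r.Adm)
    (V : GaugeField P j G) :
    rratio r fib a a V = if fibreIntegral (fib a) (rterm r a) V = 0 then 0 else 1 := by
  unfold rratio
  split_ifs with h
  · rw [h, div_zero]
  · rw [div_self h]

/-- **THE RE-SLOTTED SELF-RATIO IS THE REFERENCE ONE** under two-sided domination of the term fibre integrals with a positive lower constant: for the
representation `{ r with TexpA := T′ }` (same sequences, characters, regions; another slot family — e.g. the DRESSED slots of the same history tree) the own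
ratio `∫⌈t′_a ∕ ∫⌈t′_a` equals `∫⌈t_a ∕ ∫⌈t_a` — it is t-FREE (LENS v5 sketch §3, re-slotting inlined). [folklore] -/
theorem rratio_self_reslot_eq (iP : DecidableEq (PBond P j)) (r : Step.Repr218 P G j) (T' : r.Adm → Density P j G)
    (fib : r.Adm → Finset (PBond P j)) {m M : ℝ} (hm : 0 < m)
    (hsand : ∀ a V, m * fibreIntegral (fib a) (rterm r a) V ≤ fibreIntegral (fib a) (rterm { r with TexpA := T' } a) V ∧
      fibreIntegral (fib a) (rterm { r with TexpA := T' } a) V ≤ M * fibreIntegral (fib a) (rterm r a) V)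
    (a : r.Adm) (V : GaugeField P j G) :
    rratio { r with TexpA := T' } fib a a V = rratio r fib a a V := by
  have h0 : 0 ≤ fibreIntegral (fib a) (rterm r a) V := by
    unfold fibreIntegral; exact ENNReal.toReal_nonneg
  unfold rratio
  exact self_div_eq_of_sandwich hm h0 (hsand a V).1 (hsand a V).2

open Classical in
/-- **AT THE IDENTITY SELECTOR THE R-STEP IS A t-FREE `{0,1}`-MULTIPLIER ON EVERY DOMINATED SLOT FAMILY** (LENS v5 sketch §3, re-slotting inlined): for slots
`T′` whose term fibre integrals are sandwiched by the reference representation's, `(R_id T′)(a′)(V) = T′(a′)(V) · [∫⌈t_{a′}(V) ≠ 0]` with the REFERENCE indicator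
(def-R `rstepOfSel_TexpA`, [Balaban1989LargeFieldI] (0.3) p. 176 re-indexed; the selector-fibre of `a′` under `id` is `{a′}`).
[cite: Balaban1989LargeFieldI, (0.3) p.176 (bookkeeping)] -/
theorem rstepOfSel_id_reslot_TexpA (iP : DecidableEq (PBond P j)) (r : Step.Repr218 P G j) (T' : r.Adm → Density P j G)
    (fib : r.Adm → Finset (PBond P j)) {m M : ℝ} (hm : 0 < m)
    (hsand : ∀ a V, m * fibreIntegral (fib a) (rterm r a) V ≤ fibreIntegral (fib a) (rterm { r with TexpA := T' } a) V ∧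
      fibreIntegral (fib a) (rterm { r with TexpA := T' } a) V ≤ M * fibreIntegral (fib a) (rterm r a) V)
    (a' : r.Adm) (V : GaugeField P j G) :
    (rstepOfSel { r with TexpA := T' } id fib).TexpA a' V
      = T' a' V * (if fibreIntegral (fib a') (rterm r a') V = 0 then 0 else 1) := by
  rw [rstepOfSel_TexpA]
  show T' a' V * ∑ a ∈ Finset.univ.filter (fun a : r.Adm => id a = a'), rratio { r with TexpA := T' } fib a a' V = _
  have hS : Finset.univ.filter (fun a : r.Adm => id a = a') = {a'} := by
    ext a
    simp only [Finset.mem_filter, Finset.mem_univ, true_and, id_eq, Finset.mem_singleton]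
  rw [hS, Finset.sum_singleton, rratio_self_reslot_eq iP r T' fib hm hsand a' V, rratio_self_eq_ite iP r fib a' V]

/-! ## §2 The sandwich discharged from POINTWISE slot domination (new); §3 the birth instance -/

/-- **CONSTANT TWO-SIDED COMPARISON OF FIBRE INTEGRALS.**  For measurable real densities `f ≤ C` and `f′` with `m·f ≤ f′ ≤ M·f` pointwise, constants
`0 ≤ m`, `0 ≤ M`: `m·∫⌈f ≤ ∫⌈f′ ≤ M·∫⌈f` on every fibre (`lmarginal_mono`; the constants pull out as fibre-independent factors, `T4DressedR.lmarginal_ofReal_mul_pull`;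
finiteness from b01's `lmarginal_ofReal_le`; `f′` need not be measurable — `fibreIntegral` is an outer `lmarginal`). [folklore] -/
theorem fibreIntegral_const_sandwich (iP : DecidableEq (PBond P j)) (s : Finset (PBond P j)) {f f' : Density P j G}
    (hf : Measurable f) {C : ℝ} (hfC : ∀ V, f V ≤ C) {m M : ℝ} (hm : 0 ≤ m) (hM : 0 ≤ M)
    (hlo : ∀ V, m * f V ≤ f' V) (hhi : ∀ V, f' V ≤ M * f V) (V : GaugeField P j G) :
    m * fibreIntegral s f V ≤ fibreIntegral s f' V ∧ fibreIntegral s f' V ≤ M * fibreIntegral s f V := by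
  set μH : PBond P j → Measure G := fun _ => (HaarData.haar : Measure G) with hμH
  set Lf := (∫⋯∫⁻_s, (fun U => ENNReal.ofReal (f U)) ∂μH) V with hLf
  set Lf' := (∫⋯∫⁻_s, (fun U => ENNReal.ofReal (f' U)) ∂μH) V with hLf'
  have hmI : FibreIndep s (fun _ : GaugeField P j G => m) := fun _ _ => rfl
  have hMI : FibreIndep s (fun _ : GaugeField P j G => M) := fun _ _ => rfl
  -- lower: ofReal m * Lf ≤ Lf'
  have h1 : ENNReal.ofReal m * Lf ≤ Lf' := by
    have hmono : (∫⋯∫⁻_s, (fun U => ENNReal.ofReal (f U * m)) ∂μH) V ≤ Lf' :=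
      lmarginal_mono (fun U => ENNReal.ofReal_le_ofReal (by rw [mul_comm]; exact hlo U)) V
    rwa [lmarginal_ofReal_mul_pull s hf hmI (fun _ => hm) V] at hmono
  -- upper: Lf' ≤ ofReal M * Lf
  have h2 : Lf' ≤ ENNReal.ofReal M * Lf := by
    have hmono : Lf' ≤ (∫⋯∫⁻_s, (fun U => ENNReal.ofReal (f U * M)) ∂μH) V :=
      lmarginal_mono (fun U => ENNReal.ofReal_le_ofReal (by rw [mul_comm]; exact hhi U)) V
    rwa [lmarginal_ofReal_mul_pull s hf hMI (fun _ => hM) V] at hmono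
  have hLf_fin : Lf ≠ ∞ := ne_top_of_le_ne_top ENNReal.ofReal_ne_top (lmarginal_ofReal_le s hfC V)
  have hMLf_fin : ENNReal.ofReal M * Lf ≠ ∞ := ENNReal.mul_ne_top ENNReal.ofReal_ne_top hLf_fin
  have hLf'_fin : Lf' ≠ ∞ := ne_top_of_le_ne_top hMLf_fin h2
  simp only [fibreIntegral]
  refine ⟨?_, ?_⟩
  · calc m * Lf.toReal = (ENNReal.ofReal m * Lf).toReal := by rw [ENNReal.toReal_mul, ENNReal.toReal_ofReal hm]
      _ ≤ Lf'.toReal := ENNReal.toReal_mono hLf'_fin h1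
  · calc Lf'.toReal ≤ (ENNReal.ofReal M * Lf).toReal := ENNReal.toReal_mono hMLf_fin h2
      _ = M * Lf.toReal := by rw [ENNReal.toReal_mul, ENNReal.toReal_ofReal hM]

/-- **THE TERM SANDWICH FROM SLOT DOMINATION.**  If the re-slotted family is dominated pointwise by the reference slots, `m·T(a) ≤ T′(a) ≤ M·T(a)` (`0 ≤ m`,
`0 ≤ M`), the characters are measurable with `0 ≤ χ ≤ 1` and the reference slots measurable with `0 ≤ T ≤ C`, then the term fibre integrals are sandwiched with
the same constants: the hypothesis `hsand` of `rstepOfSel_id_reslot_TexpA`. [folklore] -/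
theorem rterm_reslot_sandwich (iP : DecidableEq (PBond P j)) (r : Step.Repr218 P G j) (T' : r.Adm → Density P j G)
    (fib : r.Adm → Finset (PBond P j)) (hχm : ∀ a, Measurable (r.χ a)) (hχ0 : ∀ a V, 0 ≤ r.χ a V) (hχ1 : ∀ a V, r.χ a V ≤ 1)
    (hTm : ∀ a, Measurable (r.TexpA a)) (hT0 : ∀ a V, 0 ≤ r.TexpA a V) {C : ℝ} (hTC : ∀ a V, r.TexpA a V ≤ C)
    {m M : ℝ} (hm : 0 ≤ m) (hM : 0 ≤ M)
    (hlo : ∀ a V, m * r.TexpA a V ≤ T' a V) (hhi : ∀ a V, T' a V ≤ M * r.TexpA a V) (a : r.Adm) (V : GaugeField P j G) :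
    m * fibreIntegral (fib a) (rterm r a) V ≤ fibreIntegral (fib a) (rterm { r with TexpA := T' } a) V ∧
      fibreIntegral (fib a) (rterm { r with TexpA := T' } a) V ≤ M * fibreIntegral (fib a) (rterm r a) V := by
  have hmeas : Measurable (rterm r a) := (hχm a).mul (hTm a)
  refine fibreIntegral_const_sandwich iP (fib a) hmeas (C := 1 * C)
    (fun V => mul_le_mul (hχ1 a V) (hTC a V) (hT0 a V) zero_le_one) hm hM (fun V => ?_) (fun V => ?_) V
  · show m * (r.χ a V * r.TexpA a V) ≤ r.χ a V * T' a V
    calc m * (r.χ a V * r.TexpA a V) = r.χ a V * (m * r.TexpA a V) := by ring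
      _ ≤ r.χ a V * T' a V := mul_le_mul_of_nonneg_left (hlo a V) (hχ0 a V)
  · show r.χ a V * T' a V ≤ M * (r.χ a V * r.TexpA a V)
    calc r.χ a V * T' a V ≤ r.χ a V * (M * r.TexpA a V) := mul_le_mul_of_nonneg_left (hhi a V) (hχ0 a V)
      _ = M * (r.χ a V * r.TexpA a V) := by ring

open Classical in
/-- **THE IDENTITY-SELECTOR R-STEP ON A DOMINATED FAMILY, FROM SLOT DOMINATION** (the composite of `rterm_reslot_sandwich` and
`rstepOfSel_id_reslot_TexpA`): `(R_id T′)(a′)(V) = T′(a′)(V) · [∫⌈t_{a′}(V) ≠ 0]` — the indicator is the REFERENCE family's, so it does not see whatever the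
re-slotting carries (a source `t`, a dressing). [cite: Balaban1989LargeFieldI, (0.3) p.176 (bookkeeping)] -/
theorem rstepOfSel_id_TexpA_of_slot_sandwich (iP : DecidableEq (PBond P j)) (r : Step.Repr218 P G j) (T' : r.Adm → Density P j G)
    (fib : r.Adm → Finset (PBond P j)) (hχm : ∀ a, Measurable (r.χ a)) (hχ0 : ∀ a V, 0 ≤ r.χ a V) (hχ1 : ∀ a V, r.χ a V ≤ 1)
    (hTm : ∀ a, Measurable (r.TexpA a)) (hT0 : ∀ a V, 0 ≤ r.TexpA a V) {C : ℝ} (hTC : ∀ a V, r.TexpA a V ≤ C)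
    {m M : ℝ} (hm : 0 < m) (hM : 0 ≤ M)
    (hlo : ∀ a V, m * r.TexpA a V ≤ T' a V) (hhi : ∀ a V, T' a V ≤ M * r.TexpA a V) (a' : r.Adm) (V : GaugeField P j G) :
    (rstepOfSel { r with TexpA := T' } id fib).TexpA a' V
      = T' a' V * (if fibreIntegral (fib a') (rterm r a') V = 0 then 0 else 1) :=
  rstepOfSel_id_reslot_TexpA iP r T' fib hm
    (rterm_reslot_sandwich iP r T' fib hχm hχ0 hχ1 hTm hT0 hTC hm.le hM hlo hhi) a' V

omit [GaugeGroup G] [MeasurableSpace G] [HaarData G] in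
/-- **THE BIRTH INSTANCE OF THE DOMINATION**: the DRESSED slots `T′(a) = T(a)·e^{t·F}` of a non-negative family, `|F| ≤ B`, are dominated by the undressed ones
with the t-uniform constants `e^{−|t|B}`, `e^{|t|B}` (`T4DressedR.exp_dressing_bounds`). [folklore] -/
theorem slot_sandwich_of_exp_dressing {A : Type*} (T : A → Density P j G) (hT0 : ∀ a V, 0 ≤ T a V) {F : Density P j G} {B : ℝ}
    (hF : ∀ V, |F V| ≤ B) (t : ℝ) (a : A) (V : GaugeField P j G) :
    Real.exp (-(|t| * B)) * T a V ≤ T a V * Real.exp (t * F V) ∧ T a V * Real.exp (t * F V) ≤ Real.exp (|t| * B) * T a V := by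
  obtain ⟨hlo, hhi⟩ := exp_dressing_bounds hF t V
  constructor
  · rw [mul_comm]; exact mul_le_mul_of_nonneg_left hlo (hT0 a V)
  · rw [mul_comm (Real.exp _)]; exact mul_le_mul_of_nonneg_left hhi (hT0 a V)

open Classical in
/-- **COROLLARY (one R-step after a dressed birth).**  For a (2.18) representation with measurable characters `0 ≤ χ ≤ 1` and measurable slots `0 ≤ T ≤ C`, and a
bounded observable `|F| ≤ B`: the identity-selector R-step of the DRESSED representation `{ r with TexpA := fun a V => T a V · e^{t F V} }` multiplies each dressed slot
by the UNDRESSED indicator `[∫⌈t_{a′} ≠ 0]` — for every real `t`. [cite: Balaban1989LargeFieldI, (0.3) p.176 (bookkeeping)] -/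
theorem rstepOfSel_id_TexpA_exp_dressing (iP : DecidableEq (PBond P j)) (r : Step.Repr218 P G j) (fib : r.Adm → Finset (PBond P j))
    (hχm : ∀ a, Measurable (r.χ a)) (hχ0 : ∀ a V, 0 ≤ r.χ a V) (hχ1 : ∀ a V, r.χ a V ≤ 1)
    (hTm : ∀ a, Measurable (r.TexpA a)) (hT0 : ∀ a V, 0 ≤ r.TexpA a V) {C : ℝ} (hTC : ∀ a V, r.TexpA a V ≤ C)
    {F : Density P j G} {B : ℝ} (hF : ∀ V, |F V| ≤ B) (t : ℝ) (a' : r.Adm) (V : GaugeField P j G) :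
    (rstepOfSel { r with TexpA := fun a V => r.TexpA a V * Real.exp (t * F V) } id fib).TexpA a' V
      = r.TexpA a' V * Real.exp (t * F V) * (if fibreIntegral (fib a') (rterm r a') V = 0 then 0 else 1) :=
  rstepOfSel_id_TexpA_of_slot_sandwich iP r (fun a V => r.TexpA a V * Real.exp (t * F V)) fib hχm hχ0 hχ1 hTm hT0 hTC
    (Real.exp_pos _) (Real.exp_pos _).le
    (fun a V => (slot_sandwich_of_exp_dressing r.TexpA hT0 hF t a V).1)
    (fun a V => (slot_sandwich_of_exp_dressing r.TexpA hT0 hF t a V).2) a' V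



/-! ## §4 (v1.1, append-only) BOUNDEDNESS-FREE: the zero sets of the fibre integrals agree under pointwise domination with `0 < m` — and that is all the
identity-selector R-step reads

v1.1 for module (c)'s measure-valued slots (`dag-n19-d` INTENT-18, pub-ymgap INBOX l.15748: its `rstepSlot_id_apply` ∕ `fibreIntegral_eq_zero_iff_of_sandwich` cite
these), whose slots `V ↦ ∫⁻ … ∂(slotMeasure k s V)` carry NO uniform bound `≤ C`: §1's `rratio_self_reslot_eq` needs only that `∫⌈t′_a` and `∫⌈t_a` VANISH TOGETHER, and
in `ℝ≥0∞` the sandwich `ofReal m · ∫⋯∫⁻ t_a ≤ ∫⋯∫⁻ t′_a ≤ ofReal M · ∫⋯∫⁻ t_a` holds with NO finiteness AND NO measurability proviso (outer integral); b01's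
`fibreIntegral` is `toReal` of it, vanishing iff the `lmarginal` is `0` or `∞`, and both cases transfer across the sandwich when `0 < m`, `M < ∞` (def-T's junk
convention `toReal ∞ = 0` matched, not excluded).  Hypotheses of the composite `rstepOfSel_id_TexpA_of_slot_sandwich'`: `0 ≤ χ`, `0 < m`, `0 ≤ M`, the pointwise
domination — nothing else.
-/

/-- The re-slotted and the reference self-ratios agree as soon as the ZERO SETS of the term fibre integrals agree (both ratios are `{0,1}`-valued indicators,
`rratio_self_eq_ite`). [folklore] -/
theorem rratio_self_reslot_eq_of_zero_iff (iP : DecidableEq (PBond P j)) (r : Step.Repr218 P G j) (T' : r.Adm → Density P j G)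
    (fib : r.Adm → Finset (PBond P j))
    (hiff : ∀ a V, fibreIntegral (fib a) (rterm { r with TexpA := T' } a) V = 0 ↔ fibreIntegral (fib a) (rterm r a) V = 0)
    (a : r.Adm) (V : GaugeField P j G) :
    rratio { r with TexpA := T' } fib a a V = rratio r fib a a V := by
  rw [rratio_self_eq_ite iP { r with TexpA := T' } fib a V, rratio_self_eq_ite iP r fib a V]
  by_cases h : fibreIntegral (fib a) (rterm r a) V = 0
  · rw [if_pos h, if_pos ((hiff a V).2 h)]
  · rw [if_neg h, if_neg (fun h' => h ((hiff a V).1 h'))]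

open Classical in
/-- **AT THE IDENTITY SELECTOR, zero-set form**: if the term fibre integrals of the re-slotted family vanish exactly where the reference ones do, then
`(R_id T′)(a′)(V) = T′(a′)(V) · [∫⌈t_{a′}(V) ≠ 0]` with the REFERENCE indicator. [cite: Balaban1989LargeFieldI, (0.3) p.176 (bookkeeping)] -/
theorem rstepOfSel_id_reslot_TexpA_of_zero_iff (iP : DecidableEq (PBond P j)) (r : Step.Repr218 P G j) (T' : r.Adm → Density P j G)
    (fib : r.Adm → Finset (PBond P j))
    (hiff : ∀ a V, fibreIntegral (fib a) (rterm { r with TexpA := T' } a) V = 0 ↔ fibreIntegral (fib a) (rterm r a) V = 0)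
    (a' : r.Adm) (V : GaugeField P j G) :
    (rstepOfSel { r with TexpA := T' } id fib).TexpA a' V
      = T' a' V * (if fibreIntegral (fib a') (rterm r a') V = 0 then 0 else 1) := by
  rw [rstepOfSel_TexpA]
  show T' a' V * ∑ a ∈ Finset.univ.filter (fun a : r.Adm => id a = a'), rratio { r with TexpA := T' } fib a a' V = _
  have hS : Finset.univ.filter (fun a : r.Adm => id a = a') = {a'} := by
    ext a
    simp only [Finset.mem_filter, Finset.mem_univ, true_and, id_eq, Finset.mem_singleton]
  rw [hS, Finset.sum_singleton, rratio_self_reslot_eq_of_zero_iff iP r T' fib hiff a' V, rratio_self_eq_ite iP r fib a' V]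

/-- A CONSTANT pulls out of the `ofReal`-fibre integral with NO measurability (`lintegral_const_mul'`; `ofReal (a·c) = ofReal c · ofReal a` for `0 ≤ c` whatever
the sign of `a`). [folklore] -/
theorem lmarginal_ofReal_mul_const (iP : DecidableEq (PBond P j)) (s : Finset (PBond P j)) (f : Density P j G) {c : ℝ} (hc : 0 ≤ c)
    (V : GaugeField P j G) :
    (∫⋯∫⁻_s, (fun U => ENNReal.ofReal (f U * c)) ∂(fun _ : PBond P j => (HaarData.haar : Measure G))) V
      = ENNReal.ofReal c * (∫⋯∫⁻_s, (fun U => ENNReal.ofReal (f U)) ∂(fun _ : PBond P j => (HaarData.haar : Measure G))) V := by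
  simp only [lmarginal]
  have hpt : ∀ y, ENNReal.ofReal (f (Function.updateFinset V s y) * c) = ENNReal.ofReal c * ENNReal.ofReal (f (Function.updateFinset V s y)) :=
    fun y => by rw [ENNReal.ofReal_mul' hc, mul_comm]
  simp_rw [hpt]
  exact lintegral_const_mul' _ _ ENNReal.ofReal_ne_top

/-- **THE `ℝ≥0∞` FIBRE SANDWICH, UNCONDITIONAL**: pointwise `m·f ≤ f′ ≤ M·f` with constants `0 ≤ m`, `0 ≤ M` gives
`ofReal m · ∫⋯∫⁻_s ofReal∘f ≤ ∫⋯∫⁻_s ofReal∘f′ ≤ ofReal M · ∫⋯∫⁻_s ofReal∘f` — no measurability, no boundedness, no finiteness (`lmarginal_mono` is monotonicity of an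
outer integral; the constants pull out by `lmarginal_ofReal_mul_const`). [folklore] -/
theorem lmarginal_ofReal_const_sandwich (iP : DecidableEq (PBond P j)) (s : Finset (PBond P j)) {f f' : Density P j G}
    {m M : ℝ} (hm : 0 ≤ m) (hM : 0 ≤ M) (hlo : ∀ V, m * f V ≤ f' V) (hhi : ∀ V, f' V ≤ M * f V) (V : GaugeField P j G) :
    ENNReal.ofReal m * (∫⋯∫⁻_s, (fun U => ENNReal.ofReal (f U)) ∂(fun _ : PBond P j => (HaarData.haar : Measure G))) V
        ≤ (∫⋯∫⁻_s, (fun U => ENNReal.ofReal (f' U)) ∂(fun _ : PBond P j => (HaarData.haar : Measure G))) V ∧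
      (∫⋯∫⁻_s, (fun U => ENNReal.ofReal (f' U)) ∂(fun _ : PBond P j => (HaarData.haar : Measure G))) V
        ≤ ENNReal.ofReal M * (∫⋯∫⁻_s, (fun U => ENNReal.ofReal (f U)) ∂(fun _ : PBond P j => (HaarData.haar : Measure G))) V := by
  refine ⟨?_, ?_⟩
  · have hmono : (∫⋯∫⁻_s, (fun U => ENNReal.ofReal (f U * m)) ∂(fun _ : PBond P j => (HaarData.haar : Measure G))) V
        ≤ (∫⋯∫⁻_s, (fun U => ENNReal.ofReal (f' U)) ∂(fun _ : PBond P j => (HaarData.haar : Measure G))) V :=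
      lmarginal_mono (fun U => ENNReal.ofReal_le_ofReal (by rw [mul_comm]; exact hlo U)) V
    rwa [lmarginal_ofReal_mul_const iP s f hm V] at hmono
  · have hmono : (∫⋯∫⁻_s, (fun U => ENNReal.ofReal (f' U)) ∂(fun _ : PBond P j => (HaarData.haar : Measure G))) V
        ≤ (∫⋯∫⁻_s, (fun U => ENNReal.ofReal (f U * M)) ∂(fun _ : PBond P j => (HaarData.haar : Measure G))) V :=
      lmarginal_mono (fun U => ENNReal.ofReal_le_ofReal (by rw [mul_comm]; exact hhi U)) V
    rwa [lmarginal_ofReal_mul_const iP s f hM V] at hmono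

/-- **THE ZERO SETS OF THE FIBRE INTEGRALS AGREE, boundedness-free**: pointwise `m·f ≤ f′ ≤ M·f` with `0 < m`, `0 ≤ M` (NO measurability, NO bound on `f`) ⇒
`∫⌈f′ = 0 ↔ ∫⌈f = 0` on every fibre — b01's `fibreIntegral` is `toReal` of the `lmarginal`, so it vanishes iff the latter is `0` or `∞`, and both cases transfer
across the unconditional sandwich (`0` downwards needs `0 < m`, `∞` upwards needs `M < ∞`). [folklore] -/
theorem fibreIntegral_eq_zero_iff_of_sandwich (iP : DecidableEq (PBond P j)) (s : Finset (PBond P j)) {f f' : Density P j G}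
    {m M : ℝ} (hm : 0 < m) (hM : 0 ≤ M) (hlo : ∀ V, m * f V ≤ f' V) (hhi : ∀ V, f' V ≤ M * f V) (V : GaugeField P j G) :
    fibreIntegral s f' V = 0 ↔ fibreIntegral s f V = 0 := by
  obtain ⟨h1, h2⟩ := lmarginal_ofReal_const_sandwich iP s hm.le hM hlo hhi V
  set Lf := (∫⋯∫⁻_s, (fun U => ENNReal.ofReal (f U)) ∂(fun _ : PBond P j => (HaarData.haar : Measure G))) V with hLf
  set Lf' := (∫⋯∫⁻_s, (fun U => ENNReal.ofReal (f' U)) ∂(fun _ : PBond P j => (HaarData.haar : Measure G))) V with hLf'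
  have hm0 : ENNReal.ofReal m ≠ 0 := (ENNReal.ofReal_pos.mpr hm).ne'
  simp only [fibreIntegral, ENNReal.toReal_eq_zero_iff]
  rw [← hLf, ← hLf']
  constructor
  · rintro (h0 | htop)
    · left
      have : ENNReal.ofReal m * Lf = 0 := le_antisymm (h0 ▸ h1) bot_le
      exact (mul_eq_zero.mp this).resolve_left hm0
    · right
      have htop' : ENNReal.ofReal M * Lf = ⊤ := eq_top_iff.mpr (htop ▸ h2)
      rcases ENNReal.mul_eq_top.mp htop' with ⟨_, h⟩ | ⟨h, _⟩
      · exact h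
      · exact absurd h ENNReal.ofReal_ne_top
  · rintro (h0 | htop)
    · left
      exact le_antisymm (by simpa [h0] using h2) bot_le
    · right
      exact eq_top_iff.mpr (by simpa [htop, ENNReal.mul_top hm0] using h1)

/-- **THE TERM ZERO SETS AGREE FROM SLOT DOMINATION, boundedness-free**: `m·T(a) ≤ T′(a) ≤ M·T(a)` pointwise (`0 < m`, `0 ≤ M`) and non-negative characters —
no measurability, no bound on the slots, no `χ ≤ 1`. [folklore] -/
theorem rterm_zero_iff_of_slot_sandwich (iP : DecidableEq (PBond P j)) (r : Step.Repr218 P G j) (T' : r.Adm → Density P j G)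
    (fib : r.Adm → Finset (PBond P j)) (hχ0 : ∀ a V, 0 ≤ r.χ a V)
    {m M : ℝ} (hm : 0 < m) (hM : 0 ≤ M) (hlo : ∀ a V, m * r.TexpA a V ≤ T' a V) (hhi : ∀ a V, T' a V ≤ M * r.TexpA a V)
    (a : r.Adm) (V : GaugeField P j G) :
    fibreIntegral (fib a) (rterm { r with TexpA := T' } a) V = 0 ↔ fibreIntegral (fib a) (rterm r a) V = 0 := by
  refine fibreIntegral_eq_zero_iff_of_sandwich iP (fib a) hm hM (fun V => ?_) (fun V => ?_) V
  · show m * (r.χ a V * r.TexpA a V) ≤ r.χ a V * T' a V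
    calc m * (r.χ a V * r.TexpA a V) = r.χ a V * (m * r.TexpA a V) := by ring
      _ ≤ r.χ a V * T' a V := mul_le_mul_of_nonneg_left (hlo a V) (hχ0 a V)
  · show r.χ a V * T' a V ≤ M * (r.χ a V * r.TexpA a V)
    calc r.χ a V * T' a V ≤ r.χ a V * (M * r.TexpA a V) := mul_le_mul_of_nonneg_left (hhi a V) (hχ0 a V)
      _ = M * (r.χ a V * r.TexpA a V) := by ring

open Classical in
/-- **THE IDENTITY-SELECTOR R-STEP FROM SLOT DOMINATION, boundedness-free** (the composite for module (c)'s unbounded measure-valued slots):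
`(R_id T′)(a′)(V) = T′(a′)(V) · [∫⌈t_{a′}(V) ≠ 0]` from `m·T ≤ T′ ≤ M·T` (`0 < m`, `0 ≤ M`) and non-negative characters — nothing else (no measurability, no
bound). [cite: Balaban1989LargeFieldI, (0.3) p.176 (bookkeeping)] -/
theorem rstepOfSel_id_TexpA_of_slot_sandwich' (iP : DecidableEq (PBond P j)) (r : Step.Repr218 P G j) (T' : r.Adm → Density P j G)
    (fib : r.Adm → Finset (PBond P j)) (hχ0 : ∀ a V, 0 ≤ r.χ a V)
    {m M : ℝ} (hm : 0 < m) (hM : 0 ≤ M) (hlo : ∀ a V, m * r.TexpA a V ≤ T' a V) (hhi : ∀ a V, T' a V ≤ M * r.TexpA a V)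
    (a' : r.Adm) (V : GaugeField P j G) :
    (rstepOfSel { r with TexpA := T' } id fib).TexpA a' V
      = T' a' V * (if fibreIntegral (fib a') (rterm r a') V = 0 then 0 else 1) :=
  rstepOfSel_id_reslot_TexpA_of_zero_iff iP r T' fib
    (rterm_zero_iff_of_slot_sandwich iP r T' fib hχ0 hm hM hlo hhi) a' V

/-! ## §5 (v1.1) At def-R's SLICE of record (`rstepSlot`, FILE 8): the identity-selector slot operation, displayed — `rstepSlot_id_apply`
(one declarer by dag-lead g7 DEDUP-248 (4), pub-ymgap INBOX l.16038; consumed by `dag-n19-d`'s A ∕ `dag-n19-c`'s live-selector layer BY NAME)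

`rstepSlot F N ν τ p g k sel f = (rstepOfSel (sliceOfRecord … f) sel (fibOfSeq …)).TexpA` by `rfl` (FILE 8), so §1 ∕ §4 specialise: the instance binder `iP` is
instantiated BY UNIFICATION with FILE 8's `open Classical` term (K0a's convention in `Record12LiveSelector` §1b), general `N`, ANY slot families. -/

section Slice

open Literature.MathematicalPhysics.QuantumFieldTheory.Balaban1983to89.B14.Eq218Concrete (chi218_nonneg)

variable (F : T4Family) (N : ℕ) [NeZero N] (ν : Stage7Numerics) (τ : TowerNumerics) {p : B12.RunParams} {g : ℕ → ℝ} {k : ℕ}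

open Classical in
/-- **`rstepSlot_id_apply`**: at the IDENTITY selector def-R's slot operation multiplies each slot by its OWN `{0,1}`-valued fibre-integral indicator —
`(R_id f)(s)(V) = f(s)(V) · [∫⌈_{Z′(s)} χ_k(s)·f(s) (V) ≠ 0]` — for ANY slot family `f` (no hypothesis; `∫⌈` is b01's `fibreIntegral`, `≠ 0` means «neither `0` nor
`∞`»). [cite: Balaban1989LargeFieldI, (0.3) p.176 (bookkeeping)] -/
theorem rstepSlot_id_apply (f : TexpASlot F N ν τ.M p g k) (s : SeqOfRecord F ν τ.M g p.K k) (V : GaugeField (F.P p.K) k (SU N)) :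
    rstepSlot F N ν τ p g k id f s V
      = f s V * (if B15.BasicStep.fibreIntegral (fibOfSeq F ν τ p g k s) (rterm (sliceOfRecord F N ν τ.M p g k f) s) V = 0 then 0 else 1) := by
  show (rstepOfSel { sliceOfRecord F N ν τ.M p g k f with TexpA := f } id (fibOfSeq F ν τ p g k)).TexpA s V = _
  exact rstepOfSel_id_reslot_TexpA_of_zero_iff _ (sliceOfRecord F N ν τ.M p g k f) f (fibOfSeq F ν τ p g k) (fun _ _ => Iff.rfl) s V

open Classical in
/-- **`rstepSlot_id_apply` WITH THE REFERENCE INDICATOR**: if the slot family `f′` is dominated pointwise by a reference family `f`, `m·f(s) ≤ f′(s) ≤ M·f(s)`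
(`0 < m`, `0 ≤ M`), then `(R_id f′)(s)(V) = f′(s)(V) · [∫⌈_{Z′(s)} χ_k(s)·f(s) (V) ≠ 0]` — the REFERENCE family's indicator (the characters `χ_k(s)` of record are
`≥ 0`, FILE 10 ∕ `chi218_nonneg`; §4 `rstepOfSel_id_TexpA_of_slot_sandwich'` at the slice — no measurability, no bound). [cite: Balaban1989LargeFieldI, (0.3) p.176 (bookkeeping)] -/
theorem rstepSlot_id_apply_of_slot_sandwich (f f' : TexpASlot F N ν τ.M p g k) {m M : ℝ} (hm : 0 < m) (hM : 0 ≤ M)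
    (hlo : ∀ s V, m * f s V ≤ f' s V) (hhi : ∀ s V, f' s V ≤ M * f s V) (s : SeqOfRecord F ν τ.M g p.K k)
    (V : GaugeField (F.P p.K) k (SU N)) :
    rstepSlot F N ν τ p g k id f' s V
      = f' s V * (if B15.BasicStep.fibreIntegral (fibOfSeq F ν τ p g k s) (rterm (sliceOfRecord F N ν τ.M p g k f) s) V = 0 then 0 else 1) := by
  have hχ0 : ∀ (a : SeqOfRecord F ν τ.M g p.K k) (W : GaugeField (F.P p.K) k (SU N)), 0 ≤ (sliceOfRecord F N ν τ.M p g k f).χ a W :=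
    fun a W => chi218_nonneg _ _ _ _ _ _ _ _ _
  show (rstepOfSel { sliceOfRecord F N ν τ.M p g k f with TexpA := f' } id (fibOfSeq F ν τ p g k)).TexpA s V = _
  exact rstepOfSel_id_TexpA_of_slot_sandwich' _ (sliceOfRecord F N ν τ.M p g k f) f' (fibOfSeq F ν τ p g k) hχ0 hm hM hlo hhi s V

end Slice

end Summit.QuantumFields.YangMills.BalabanUVNodes.N19MGFFormKernelChainRStep

end
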